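import Mathlib.MeasureTheory.Integral.Marginal
import Literature.Probability.LatticeModels.ONModel
import HarnessLib

/-!
# The O(N) kernels form a specification (countable graphs)

Companion ("Proofs") file of `Literature/Probability/LatticeModels/ONModel.lean`. That file defines the
finite-volume O(N) (N-vector) measures `onMeasure G Λ β bc` (Mathlib `Measure.tilted` of the glued product
of uniform sphere measures) and the candidate specification
`onSpecification G β Λ η = onMeasure G Λ β (.fixed η)`, and records Georgii's specification axioms for it
as the NAMED FACT `isSpecification_onSpecification` (Friedli–Velenik 2017, Lemma 6.20 / §6.10; Georgii
2011, Prop. 2.5 with Def. 2.9). Here the axioms are PROVED for a locally finite graph on a **countable**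
vertex set (Georgii's standing assumption; for uncountable `V` the a.e.-properness axiom of
`IsSpecification` is unsatisfiable, see the warning on `IsSpecification.proper`, so the named fact —
which quantifies over every `V` through its section variables — cannot be discharged as stated; what
is proved here is exactly its countable case, `isSpecification_onSpecification_of_countable`, and in
particular the `ℤ^d` case `isSpecification_onSpecification_zd` used by `onGibbsMeasures`).

## Contents

* `Measurable.measurable_cylinderEvents_of_dependsOn` — a measurable function of the configuration
  depending only on the coordinates in `Δ` is measurable for the cylinder σ-algebra `𝓕_Δ`.
* `onBoltzmannWeight G Λ β σ = exp (β ∑_{e ∈ ℰ^b_Λ} ⟪σ_x, σ_y⟫)` (as `ℝ≥0∞`), the fixed-boundary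
  Boltzmann factor, with its two-sided bounds `exp (∓|β| |ℰ^b_Λ|)`.
* `lintegral_onSpecification` — **integration against `γ_Λ(· | η)` is a ratio of marginal
  integrals** (Mathlib `MeasureTheory.lmarginal`, `∫⋯∫⁻_Λ`):
  `∫⁻ F dγ_Λ(· | η) = (∫⋯∫⁻_Λ w F)(η) / (∫⋯∫⁻_Λ w)(η)` (Friedli–Velenik 2017, eq. (6.29)/(6.31);
  Georgii 2011, Def. 2.9, `γ_Λ(dσ | η) = Z_Λ(η)⁻¹ e^{-βH_Λ(σ)} (ν^Λ ⊗ δ_{η_{Λᶜ}})(dσ)`).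
* `measurable_onSpecification_apply` (𝓕_{Λᶜ}-measurability), `ae_eqOn_compl_onSpecification`
  (properness, `[Countable V]`), `lintegral_onSpecification_consistent` (consistency
  `γ_{Λ'} γ_Λ = γ_{Λ'}`, `Λ ⊆ Λ'`, via Mathlib `lmarginal_eq_of_subset`: the Boltzmann factor of `Λ'`
  is that of `Λ` times a factor not depending on the spins in `Λ`, Friedli–Velenik 2017, Lemma 6.7 /
  Lemma 6.20), and the assembled `isSpecification_onSpecification_of_countable`,
  `isSpecification_onSpecification_zd`.

## References

* S. Friedli, Y. Velenik, *Statistical Mechanics of Lattice Systems* (CUP 2017), §6.2–6.3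
  (Def. 6.9, Lemma 6.7, eq. (6.29)–(6.31), Lemma 6.20), §6.10 (general single-spin spaces), §9.1.
* H.-O. Georgii, *Gibbs Measures and Phase Transitions*, 2nd ed. (de Gruyter 2011), Def. 1.23,
  Def. 2.9, Prop. 2.5.
-/

noncomputable section

open MeasureTheory Finset Function
open scoped ENNReal RealInnerProductSpace

namespace Literature.Probability.LatticeModels

variable {V : Type*} {N : ℕ}

/-! ### Local measurable functions are measurable for the cylinder σ-algebra -/

section DependsOn

variable {S : Type*} [MeasurableSpace S] {α : Type*} [MeasurableSpace α]

/-- A function of the configuration which is measurable (for the product σ-algebra) and depends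
only on the coordinates in `Δ` is measurable for the cylinder σ-algebra `𝓕_Δ = cylinderEvents Δ`:
it factors through the restriction `σ ↦ σ|_Δ` (Georgii 2011, §1.2, `𝓕_Δ`-measurable = function of
`σ_Δ`; Friedli–Velenik 2017, §6.2). [cite: Georgii2011, §1.2] -/
theorem _root_.Measurable.measurable_cylinderEvents_of_dependsOn {h : (V → S) → α}
    (hm : Measurable h) {Δ : Set V} (hdep : DependsOn h Δ) :
    Measurable[cylinderEvents (X := fun _ : V => S) Δ] h := by
  classical
  rcases isEmpty_or_nonempty (V → S) with hE | ⟨⟨σ₀⟩⟩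
  · exact @Subsingleton.measurable (V → S) α h (cylinderEvents (X := fun _ : V => S) Δ) _ _
  · let e : (Δ → S) → (V → S) := fun ρ y => if hy : y ∈ Δ then ρ ⟨y, hy⟩ else σ₀ y
    have he : Measurable e := measurable_pi_lambda _ fun y => by
      by_cases hy : y ∈ Δ
      · simp only [e, hy, dite_true]
        exact measurable_pi_apply _
      · simp only [e, hy, dite_false]
        exact measurable_const
    have hfac : h = (h ∘ e) ∘ Set.restrict Δ := by
      funext η
      simp only [Function.comp_apply]
      refine hdep fun i hi => ?_
      simp [e, hi]
    rw [hfac]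
    exact (hm.comp he).comp (measurable_restrict_cylinderEvents Δ)

/-- A marginal integral `∫⋯∫⁻_Λ f` over the coordinates in `Λ` does not depend on those coordinates
(Mathlib `lmarginal_congr`), phrased with `DependsOn`. [folklore] -/
theorem dependsOn_lmarginal_compl [DecidableEq V] (ν : Measure S) (Λ : Finset V)
    (f : (V → S) → ℝ≥0∞) :
    DependsOn (∫⋯∫⁻_Λ, f ∂fun _ : V => ν) ((↑Λ : Set V)ᶜ) := fun _ _ h =>
  lmarginal_congr (fun _ : V => ν) f fun i hi => h i (by simpa using hi)

/-- A factor depending only on the coordinates off `Λ` can be pulled out of a marginal integral over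
the coordinates in `Λ`: `∫⋯∫⁻_Λ (g f)(x) = g(x) ∫⋯∫⁻_Λ f (x)`. [folklore] -/
theorem lmarginal_mul_left_of_dependsOn [DecidableEq V] (ν : Measure S) (Λ : Finset V)
    {g f : (V → S) → ℝ≥0∞} (hg : DependsOn g ((↑Λ : Set V)ᶜ)) (hf : Measurable f) (x : V → S) :
    (∫⋯∫⁻_Λ, (fun σ => g σ * f σ) ∂fun _ : V => ν) x = g x * (∫⋯∫⁻_Λ, f ∂fun _ : V => ν) x := by
  have hgx : ∀ ζ : ↥Λ → S, g (updateFinset x Λ ζ) = g x := fun ζ =>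
    hg fun i hi => by
      have hi' : i ∉ Λ := by simpa using hi
      simp [updateFinset, hi']
  simp only [lmarginal, hgx]
  exact lintegral_const_mul _ (hf.comp measurable_updateFinset)

end DependsOn

/-! ### The fixed-boundary Boltzmann factor -/

section Weight

variable (G : SimpleGraph V) [DecidableEq V] [G.LocallyFinite]

/-- The fixed-boundary Boltzmann factor of the O(N) model in `Λ`, as an `ℝ≥0∞`-valued function:
`w_Λ(σ) = exp (-β H^η_Λ(σ)) = exp (β ∑_{{x,y} ∈ ℰ^b_Λ} ⟪σ_x, σ_y⟫)` (the Hamiltonian with a fixed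
boundary condition sums over the edges touching `Λ`, whatever the boundary configuration)
(Friedli–Velenik 2017, eq. (9.2) with §3.1 and eq. (6.29)). [cite: FriedliVelenik2017, eq. (9.2) with eq. (6.29)] -/
def onBoltzmannWeight (Λ : Finset V) (β : ℝ) (σ : ONConfig V N) : ℝ≥0∞ :=
  ENNReal.ofReal (Real.exp (β * ∑ e ∈ edgesTouching G Λ, onBond σ e))

/-- The fixed-boundary Hamiltonian is `-∑_{e ∈ ℰ^b_Λ} ⟪σ_x, σ_y⟫`, independently of the boundary
configuration in the `bc` slot (Friedli–Velenik 2017, eq. (9.2) with eq. (3.6)). [cite: FriedliVelenik2017, eq. (9.2) with eq. (3.6)] -/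
theorem onHamiltonian_fixed (Λ : Finset V) (η σ : ONConfig V N) :
    onHamiltonian G Λ (.fixed η) σ = -∑ e ∈ edgesTouching G Λ, onBond σ e := rfl

/-- `exp (-β H^η_Λ(σ))` is the Boltzmann factor `onBoltzmannWeight` (as a real number)
(Friedli–Velenik 2017, eq. (6.29)). [cite: FriedliVelenik2017, eq. (6.29)] -/
theorem exp_neg_mul_onHamiltonian_fixed (Λ : Finset V) (β : ℝ) (η σ : ONConfig V N) :
    Real.exp (-β * onHamiltonian G Λ (.fixed η) σ) =
      Real.exp (β * ∑ e ∈ edgesTouching G Λ, onBond σ e) := by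
  rw [onHamiltonian_fixed]; ring_nf

/-- The Boltzmann factor is measurable (Friedli–Velenik 2017, §6.2). [cite: FriedliVelenik2017, §6.2] -/
@[fun_prop]
theorem measurable_onBoltzmannWeight (Λ : Finset V) (β : ℝ) :
    Measurable (onBoltzmannWeight (N := N) G Λ β) :=
  (Real.measurable_exp.comp ((Finset.measurable_sum _ fun e _ => measurable_onBond e).const_mul
    _)).ennreal_ofReal

/-- `|β ∑_{e ∈ ℰ^b_Λ} ⟪σ_x, σ_y⟫| ≤ |β| |ℰ^b_Λ|` (Friedli–Velenik 2017, §9.1). [cite: FriedliVelenik2017, §9.1] -/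
theorem abs_mul_sum_onBond_le (Λ : Finset V) (β : ℝ) (σ : ONConfig V N) :
    |β * ∑ e ∈ edgesTouching G Λ, onBond σ e| ≤ |β| * #(edgesTouching G Λ) := by
  rw [abs_mul]
  refine mul_le_mul_of_nonneg_left ?_ (abs_nonneg β)
  refine (Finset.abs_sum_le_sum_abs _ _).trans ?_
  calc ∑ e ∈ edgesTouching G Λ, |onBond σ e| ≤ ∑ _e ∈ edgesTouching G Λ, (1 : ℝ) :=
        Finset.sum_le_sum fun e _ => abs_onBond_le_one σ e
    _ = _ := by simp

/-- Upper bound `w_Λ ≤ exp (|β| |ℰ^b_Λ|)` (Friedli–Velenik 2017, §9.1). [cite: FriedliVelenik2017, §9.1] -/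
theorem onBoltzmannWeight_le (Λ : Finset V) (β : ℝ) (σ : ONConfig V N) :
    onBoltzmannWeight G Λ β σ ≤ ENNReal.ofReal (Real.exp (|β| * #(edgesTouching G Λ))) := by
  refine ENNReal.ofReal_le_ofReal (Real.exp_le_exp.2 ?_)
  exact (le_abs_self _).trans (abs_mul_sum_onBond_le G Λ β σ)

/-- Lower bound `exp (-|β| |ℰ^b_Λ|) ≤ w_Λ` (Friedli–Velenik 2017, §9.1). [cite: FriedliVelenik2017, §9.1] -/
theorem le_onBoltzmannWeight (Λ : Finset V) (β : ℝ) (σ : ONConfig V N) :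
    ENNReal.ofReal (Real.exp (-(|β| * #(edgesTouching G Λ)))) ≤ onBoltzmannWeight G Λ β σ := by
  refine ENNReal.ofReal_le_ofReal (Real.exp_le_exp.2 ?_)
  exact (neg_le_neg (abs_mul_sum_onBond_le G Λ β σ)).trans (neg_abs_le _)

/-- The Boltzmann factor is (strictly) positive. [folklore] -/
theorem onBoltzmannWeight_ne_zero (Λ : Finset V) (β : ℝ) (σ : ONConfig V N) :
    onBoltzmannWeight G Λ β σ ≠ 0 := by
  simp [onBoltzmannWeight, Real.exp_pos]

/-- The Boltzmann factor is finite. [folklore] -/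
theorem onBoltzmannWeight_ne_top (Λ : Finset V) (β : ℝ) (σ : ONConfig V N) :
    onBoltzmannWeight G Λ β σ ≠ ∞ := ENNReal.ofReal_ne_top

end Weight

/-! ### Integration against the finite-volume measure: marginal integrals -/

section Marginal

variable (G : SimpleGraph V) [DecidableEq V] [G.LocallyFinite] [NeZero N]

/-- Integration against the glued reference measure is a marginal integral over the spins in `Λ`:
`∫⁻ F d(ν^{⊗Λ} ∘ (· ∨ η_{Λᶜ})⁻¹) = (∫⋯∫⁻_Λ F)(η)` (Friedli–Velenik 2017, eq. (6.29); Mathlib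
`MeasureTheory.lmarginal`). [cite: FriedliVelenik2017, eq. (6.29)] -/
theorem lintegral_map_onGlue_onReference (Λ : Finset V) (η : ONConfig V N)
    {F : ONConfig V N → ℝ≥0∞} (hF : Measurable F) :
    ∫⁻ σ, F σ ∂((onReference N Λ).map (onGlue Λ · (.fixed η))) =
      (∫⋯∫⁻_Λ, F ∂fun _ : V => sphereUniform N) η := by
  rw [lintegral_map hF (measurable_onGlue Λ _)]
  simp only [onGlue, ONBoundary.outside_fixed, glueWith_eq_updateFinset, lmarginal, onReference]

/-- The marginal integral of the Boltzmann factor lies between `exp (∓|β| |ℰ^b_Λ|)`; in particular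
it is neither `0` nor `∞` (Friedli–Velenik 2017, §9.1, `0 < Z < ∞`). [cite: FriedliVelenik2017, §9.1] -/
theorem lmarginal_onBoltzmannWeight_ne_zero (Λ : Finset V) (β : ℝ) (η : ONConfig V N) :
    (∫⋯∫⁻_Λ, onBoltzmannWeight G Λ β ∂fun _ : V => sphereUniform N) η ≠ 0 := by
  have hle : (∫⋯∫⁻_Λ, (fun _ => ENNReal.ofReal (Real.exp (-(|β| * #(edgesTouching G Λ)))))
      ∂fun _ : V => sphereUniform N) η ≤
      (∫⋯∫⁻_Λ, onBoltzmannWeight G Λ β ∂fun _ : V => sphereUniform N) η :=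
    lmarginal_mono (fun σ => le_onBoltzmannWeight G Λ β σ) η
  refine fun h0 => ?_
  rw [h0, nonpos_iff_eq_zero] at hle
  simp only [lmarginal, lintegral_const, measure_univ, mul_one, ENNReal.ofReal_eq_zero, not_le.2
    (Real.exp_pos _)] at hle

/-- The marginal integral of the Boltzmann factor is finite (Friedli–Velenik 2017, §9.1). [cite: FriedliVelenik2017, §9.1] -/
theorem lmarginal_onBoltzmannWeight_ne_top (Λ : Finset V) (β : ℝ) (η : ONConfig V N) :
    (∫⋯∫⁻_Λ, onBoltzmannWeight G Λ β ∂fun _ : V => sphereUniform N) η ≠ ∞ := by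
  have hle : (∫⋯∫⁻_Λ, onBoltzmannWeight G Λ β ∂fun _ : V => sphereUniform N) η ≤
      (∫⋯∫⁻_Λ, (fun _ => ENNReal.ofReal (Real.exp (|β| * #(edgesTouching G Λ))))
        ∂fun _ : V => sphereUniform N) η :=
    lmarginal_mono (fun σ => onBoltzmannWeight_le G Λ β σ) η
  refine ne_top_of_le_ne_top ?_ hle
  simp [lmarginal, lintegral_const, measure_univ]

/-- The partition function is the marginal integral of the Boltzmann factor:
`Z^η_Λ = (∫⋯∫⁻_Λ w_Λ)(η)` (as `ℝ≥0∞`) (Friedli–Velenik 2017, eq. (6.30)). [cite: FriedliVelenik2017, eq. (6.30)] -/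
theorem ofReal_onPartitionFunction_fixed (Λ : Finset V) (β : ℝ) (η : ONConfig V N) :
    ENNReal.ofReal (onPartitionFunction G Λ β (.fixed η)) =
      (∫⋯∫⁻_Λ, onBoltzmannWeight G Λ β ∂fun _ : V => sphereUniform N) η := by
  rw [onPartitionFunction, ofReal_integral_eq_lintegral_ofReal (integrable_exp_onHamiltonian G Λ β _)
    (ae_of_all _ fun _ => (Real.exp_pos _).le),
    ← lintegral_map_onGlue_onReference Λ η (measurable_onBoltzmannWeight G Λ β)]
  refine lintegral_congr fun σ => ?_
  rw [onBoltzmannWeight, exp_neg_mul_onHamiltonian_fixed]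

/-- **Integration against `γ_Λ(· | η)` is a ratio of marginal integrals** (Friedli–Velenik 2017,
Def. 6.9 with eqs. (6.29)–(6.31); Georgii 2011, Def. 2.9:
`γ_Λ(dσ | η) = Z_Λ(η)⁻¹ e^{-β H_Λ(σ)} (ν^{⊗Λ} ⊗ δ_{η_{Λᶜ}})(dσ)`): for measurable `F ≥ 0`,
`∫⁻ F dγ_Λ(· | η) = (∫⋯∫⁻_Λ w_Λ F)(η) / (∫⋯∫⁻_Λ w_Λ)(η)`. [cite: FriedliVelenik2017, Def. 6.9 with eqs. (6.29)–(6.31)] -/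
theorem lintegral_onSpecification (β : ℝ) (Λ : Finset V) (η : ONConfig V N)
    {F : ONConfig V N → ℝ≥0∞} (hF : Measurable F) :
    ∫⁻ σ, F σ ∂(onSpecification G β Λ η) =
      (∫⋯∫⁻_Λ, (fun σ => onBoltzmannWeight G Λ β σ * F σ) ∂fun _ : V => sphereUniform N) η /
        (∫⋯∫⁻_Λ, onBoltzmannWeight G Λ β ∂fun _ : V => sphereUniform N) η := by
  have hZ : 0 < onPartitionFunction G Λ β (.fixed η) := onPartitionFunction_pos G Λ β _
  rw [onSpecification_apply, onMeasure, lintegral_tilted]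
  have hZdef : ∫ s, Real.exp (-β * onHamiltonian G Λ (.fixed η) s)
      ∂(onReference N Λ).map (onGlue Λ · (.fixed η)) = onPartitionFunction G Λ β (.fixed η) := rfl
  have hdens : ∀ σ : ONConfig V N,
      ENNReal.ofReal (Real.exp (-β * onHamiltonian G Λ (.fixed η) σ) /
        ∫ s, Real.exp (-β * onHamiltonian G Λ (.fixed η) s)
          ∂(onReference N Λ).map (onGlue Λ · (.fixed η))) =
        (ENNReal.ofReal (onPartitionFunction G Λ β (.fixed η)))⁻¹ * onBoltzmannWeight G Λ β σ := by
    intro σ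
    rw [hZdef, ENNReal.ofReal_div_of_pos hZ, exp_neg_mul_onHamiltonian_fixed,
      ENNReal.div_eq_inv_mul]
    rfl
  simp_rw [hdens, mul_assoc]
  rw [lintegral_const_mul _ ((measurable_onBoltzmannWeight G Λ β).fun_mul hF),
    lintegral_map_onGlue_onReference Λ η ((measurable_onBoltzmannWeight G Λ β).fun_mul hF),
    ofReal_onPartitionFunction_fixed, ENNReal.div_eq_inv_mul]

/-- **The kernel on events**: `γ_Λ(A | η) = (∫⋯∫⁻_Λ w_Λ 1_A)(η) / (∫⋯∫⁻_Λ w_Λ)(η)` for measurable `A`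
(Friedli–Velenik 2017, Def. 6.9 / eq. (6.31)). [cite: FriedliVelenik2017, Def. 6.9 / eq. (6.31)] -/
theorem onSpecification_apply_eq (β : ℝ) (Λ : Finset V) (η : ONConfig V N)
    {A : Set (ONConfig V N)} (hA : MeasurableSet A) :
    onSpecification G β Λ η A =
      (∫⋯∫⁻_Λ, (fun σ => onBoltzmannWeight G Λ β σ * A.indicator 1 σ)
          ∂fun _ : V => sphereUniform N) η /
        (∫⋯∫⁻_Λ, onBoltzmannWeight G Λ β ∂fun _ : V => sphereUniform N) η := by
  rw [← lintegral_indicator_one hA, lintegral_onSpecification G β Λ η (measurable_one.indicator hA)]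

/-- `γ_Λ(A | η)` depends on `η` only through `η|_{Λᶜ}` (Friedli–Velenik 2017, Def. 6.9 (properness /
`𝓕_{Λᶜ}`-measurability)). [cite: FriedliVelenik2017, Def. 6.9] -/
theorem dependsOn_onSpecification_apply (β : ℝ) (Λ : Finset V) {A : Set (ONConfig V N)}
    (hA : MeasurableSet A) :
    DependsOn (fun η => onSpecification G β Λ η A) ((↑Λ : Set V)ᶜ) := by
  intro η η' h
  simp only [onSpecification_apply_eq G β Λ _ hA]
  rw [dependsOn_lmarginal_compl (sphereUniform N) Λ _ h,
    dependsOn_lmarginal_compl (sphereUniform N) Λ _ h]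

/-- `η ↦ γ_Λ(A | η)` is measurable for the full product σ-algebra (Friedli–Velenik 2017, Def. 6.9).
[cite: FriedliVelenik2017, Def. 6.9] -/
theorem measurable_onSpecification_apply' (β : ℝ) (Λ : Finset V) {A : Set (ONConfig V N)}
    (hA : MeasurableSet A) :
    Measurable fun η => onSpecification G β Λ η A := by
  simp only [onSpecification_apply_eq G β Λ _ hA, ENNReal.div_eq_inv_mul]
  refine Measurable.fun_mul (Measurable.fun_inv ?_) ?_
  · exact (measurable_onBoltzmannWeight G Λ β).lmarginal _
  · exact ((measurable_onBoltzmannWeight G Λ β).fun_mul (measurable_one.indicator hA)).lmarginal _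

/-- **`𝓕_{Λᶜ}`-measurability of the O(N) kernels** (Georgii 2011, Def. 1.23 (ii); Friedli–Velenik
2017, Def. 6.9): `η ↦ γ_Λ(A | η)` is measurable for the outside σ-algebra, being a measurable
function of `η` which depends on `η|_{Λᶜ}` only. [cite: Georgii2011, Def. 1.23 (ii)] -/
theorem measurable_onSpecification_apply (β : ℝ) (Λ : Finset V) {A : Set (ONConfig V N)}
    (hA : MeasurableSet A) :
    Measurable[cylinderEvents (X := fun _ : V => SphereSpin N) ((↑Λ : Set V)ᶜ)]
      fun η => onSpecification G β Λ η A :=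
  (measurable_onSpecification_apply' G β Λ hA).measurable_cylinderEvents_of_dependsOn
    (dependsOn_onSpecification_apply G β Λ hA)

/-- **Properness of the O(N) kernels** (Georgii 2011, Def. 1.23 (ii); Friedli–Velenik 2017, §6.2,
`μ^η_Λ(Ω^η_Λ) = 1`): on a countable vertex set, `γ_Λ(· | η)`-almost every configuration agrees with
`η` off `Λ` — the glued reference measure is carried by such configurations and `Measure.tilted` is
absolutely continuous with respect to it. [cite: Georgii2011, Def. 1.23 (ii)] -/
theorem ae_eqOn_compl_onSpecification [Countable V] (β : ℝ) (Λ : Finset V) (η : ONConfig V N) :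
    ∀ᵐ σ ∂(onSpecification G β Λ η), ∀ x ∉ Λ, σ x = η x := by
  have hS : MeasurableSet {σ : ONConfig V N | ∀ x ∉ Λ, σ x = η x} := by
    have : {σ : ONConfig V N | ∀ x ∉ Λ, σ x = η x} =
        ⋂ x ∈ ((↑Λ : Set V)ᶜ), (fun σ : ONConfig V N => σ x) ⁻¹' {η x} := by
      ext σ; simp
    rw [this]
    exact MeasurableSet.biInter (Set.to_countable _) fun x _ =>
      measurable_pi_apply x (measurableSet_singleton _)
  have href : ∀ᵐ σ ∂((onReference N Λ).map (onGlue Λ · (.fixed η))), ∀ x ∉ Λ, σ x = η x := by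
    rw [ae_map_iff (measurable_onGlue Λ _).aemeasurable hS]
    exact ae_of_all _ fun ζ x hx => by
      simp [onGlue, glueWith_apply_not_mem _ _ _ hx]
  rw [onSpecification_apply, onMeasure]
  exact href.filter_mono (tilted_absolutelyContinuous _ _).ae_le

/-! ### Consistency -/

omit [NeZero N] in
/-- For `Λ ⊆ Λ'` every edge touching `Λ` touches `Λ'` (a private copy of
`edgesTouching_mono` of `IsingMonotonicity.lean`, to keep the imports of this file small). [folklore] -/
private theorem edgesTouching_mono_aux {Λ Λ' : Finset V} (h : Λ ⊆ Λ') :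
    edgesTouching G Λ ⊆ edgesTouching G Λ' := by
  intro e he
  rw [mem_edgesTouching_iff] at he ⊢
  exact ⟨he.1, he.2.imp fun x hx => ⟨h hx.1, hx.2⟩⟩

/-- The Boltzmann factor of the edges touching `Λ'` but not `Λ`,
`w^{out}_{Λ,Λ'}(σ) = exp (β ∑_{e ∈ ℰ^b_{Λ'} ∖ ℰ^b_Λ} ⟪σ_x, σ_y⟫)`; for `Λ ⊆ Λ'` it is the ratio
`w_{Λ'} / w_Λ` and does not depend on the spins in `Λ` (Friedli–Velenik 2017, proof of Lemma 6.7,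
`H_{Λ'} = H_Λ + (terms not involving Λ)`). [cite: FriedliVelenik2017, Lemma 6.7] -/
def onBoltzmannWeightOut (Λ Λ' : Finset V) (β : ℝ) (σ : ONConfig V N) : ℝ≥0∞ :=
  ENNReal.ofReal (Real.exp (β * ∑ e ∈ edgesTouching G Λ' \ edgesTouching G Λ, onBond σ e))

omit [NeZero N] in
/-- `w^{out}` is measurable (Friedli–Velenik 2017, §6.2). [cite: FriedliVelenik2017, §6.2] -/
theorem measurable_onBoltzmannWeightOut (Λ Λ' : Finset V) (β : ℝ) :
    Measurable (onBoltzmannWeightOut (N := N) G Λ Λ' β) :=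
  (Real.measurable_exp.comp ((Finset.measurable_sum _ fun e _ => measurable_onBond e).const_mul
    _)).ennreal_ofReal

omit [NeZero N] in
/-- `w^{out}_{Λ,Λ'}` depends only on the spins off `Λ` (an edge touching `Λ'` but not `Λ` has no
endpoint in `Λ`) (Friedli–Velenik 2017, proof of Lemma 6.7). [cite: FriedliVelenik2017, Lemma 6.7] -/
theorem dependsOn_onBoltzmannWeightOut (Λ Λ' : Finset V) (β : ℝ) :
    DependsOn (onBoltzmannWeightOut (N := N) G Λ Λ' β) ((↑Λ : Set V)ᶜ) := by
  intro σ σ' h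
  simp only [onBoltzmannWeightOut]
  congr 3
  refine Finset.sum_congr rfl fun e he => ?_
  rw [Finset.mem_sdiff, mem_edgesTouching_iff, mem_edgesTouching_iff] at he
  obtain ⟨⟨he', -⟩, hnot⟩ := he
  have hout : ∀ x ∈ e, x ∉ Λ := fun x hx hxΛ => hnot ⟨he', x, hxΛ, hx⟩
  induction e using Sym2.ind with
  | _ x y =>
    rw [onBond_mk, onBond_mk, h x (by simpa using hout x (Sym2.mem_mk_left x y)),
      h y (by simpa using hout y (Sym2.mem_mk_right x y))]

omit [NeZero N] in
/-- Factorisation of the Boltzmann factors, `w_{Λ'} = w^{out}_{Λ,Λ'} · w_Λ` for `Λ ⊆ Λ'`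
(Friedli–Velenik 2017, proof of Lemma 6.7). [cite: FriedliVelenik2017, Lemma 6.7] -/
theorem onBoltzmannWeight_eq_mul {Λ Λ' : Finset V} (h : Λ ⊆ Λ') (β : ℝ) (σ : ONConfig V N) :
    onBoltzmannWeight G Λ' β σ = onBoltzmannWeightOut G Λ Λ' β σ * onBoltzmannWeight G Λ β σ := by
  rw [onBoltzmannWeight, onBoltzmannWeight, onBoltzmannWeightOut,
    ← ENNReal.ofReal_mul (Real.exp_pos _).le, ← Real.exp_add, ← mul_add,
    Finset.sum_sdiff (edgesTouching_mono_aux G h)]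

/-- The core of the consistency computation (Friedli–Velenik 2017, proof of Lemma 6.7): for
`Λ ⊆ Λ'`, integrating `w_{Λ'} · γ_Λ(A | ·)` over the spins in `Λ` gives the same as integrating
`w_{Λ'} 1_A`, because `w_{Λ'} = w^{out} w_Λ` with `w^{out}` and `γ_Λ(A | ·)` blind to those spins
and `Z_Λ(σ) γ_Λ(A | σ) = (∫⋯∫⁻_Λ w_Λ 1_A)(σ)`. [cite: FriedliVelenik2017, Lemma 6.7] -/
theorem lmarginal_onBoltzmannWeight_mul_onSpecification (β : ℝ) {Λ Λ' : Finset V} (hsub : Λ ⊆ Λ')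
    (σ : ONConfig V N) {A : Set (ONConfig V N)} (hA : MeasurableSet A) :
    (∫⋯∫⁻_Λ, (fun τ => onBoltzmannWeight G Λ' β τ * onSpecification G β Λ τ A)
        ∂fun _ : V => sphereUniform N) σ =
      (∫⋯∫⁻_Λ, (fun τ => onBoltzmannWeight G Λ' β τ * A.indicator 1 τ)
        ∂fun _ : V => sphereUniform N) σ := by
  have hqm : Measurable fun τ => onSpecification G β Λ τ A :=
    measurable_onSpecification_apply' G β Λ hA
  have hind : Measurable (A.indicator (1 : ONConfig V N → ℝ≥0∞)) := measurable_one.indicator hA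
  have hwm : Measurable (onBoltzmannWeight (N := N) G Λ β) := measurable_onBoltzmannWeight G Λ β
  have hq_dep : DependsOn (fun τ => onSpecification G β Λ τ A) ((↑Λ : Set V)ᶜ) :=
    dependsOn_onSpecification_apply G β Λ hA
  have hwout_dep := dependsOn_onBoltzmannWeightOut (N := N) G Λ Λ' β
  have hZ0 := lmarginal_onBoltzmannWeight_ne_zero G Λ β σ
  have hZtop := lmarginal_onBoltzmannWeight_ne_top G Λ β σ
  calc (∫⋯∫⁻_Λ, (fun τ => onBoltzmannWeight G Λ' β τ * onSpecification G β Λ τ A)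
        ∂fun _ : V => sphereUniform N) σ
      = (∫⋯∫⁻_Λ, (fun τ => onBoltzmannWeightOut G Λ Λ' β τ *
          (onSpecification G β Λ τ A * onBoltzmannWeight G Λ β τ))
            ∂fun _ : V => sphereUniform N) σ := by
        congr 1; funext τ; rw [onBoltzmannWeight_eq_mul G hsub]; ring
    _ = onBoltzmannWeightOut G Λ Λ' β σ * (onSpecification G β Λ σ A *
          (∫⋯∫⁻_Λ, onBoltzmannWeight G Λ β ∂fun _ : V => sphereUniform N) σ) := by
        rw [lmarginal_mul_left_of_dependsOn _ Λ hwout_dep (hqm.fun_mul hwm),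
          lmarginal_mul_left_of_dependsOn _ Λ hq_dep hwm]
    _ = onBoltzmannWeightOut G Λ Λ' β σ *
          (∫⋯∫⁻_Λ, (fun τ => onBoltzmannWeight G Λ β τ * A.indicator 1 τ)
            ∂fun _ : V => sphereUniform N) σ := by
        rw [onSpecification_apply_eq G β Λ σ hA, ENNReal.div_mul_cancel hZ0 hZtop]
    _ = (∫⋯∫⁻_Λ, (fun τ => onBoltzmannWeightOut G Λ Λ' β τ *
          (onBoltzmannWeight G Λ β τ * A.indicator 1 τ)) ∂fun _ : V => sphereUniform N) σ := by
        rw [lmarginal_mul_left_of_dependsOn _ Λ hwout_dep (hwm.fun_mul hind)]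
    _ = (∫⋯∫⁻_Λ, (fun τ => onBoltzmannWeight G Λ' β τ * A.indicator 1 τ)
        ∂fun _ : V => sphereUniform N) σ := by
        congr 1; funext τ; rw [onBoltzmannWeight_eq_mul G hsub, mul_assoc]

/-- **Consistency of the O(N) kernels** (Georgii 2011, Def. 1.23 (iii); Friedli–Velenik 2017,
Lemma 6.7 / Lemma 6.20, `γ_{Λ'} γ_Λ = γ_{Λ'}` for `Λ ⊆ Λ'`):
`∫ γ_Λ(A | σ) γ_{Λ'}(dσ | η) = γ_{Λ'}(A | η)`. Proof: both sides are `(∫⋯∫⁻_{Λ'} w_{Λ'} ·)(η) / Z_{Λ'}(η)`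
applied to `γ_Λ(A | ·)` and to `1_A`, and the two marginal integrals agree once the spins in `Λ`
are integrated out first (Mathlib `lmarginal_eq_of_subset` and
`lmarginal_onBoltzmannWeight_mul_onSpecification`). [cite: FriedliVelenik2017, Lemma 6.7] -/
theorem lintegral_onSpecification_consistent (β : ℝ) {Λ Λ' : Finset V} (hsub : Λ ⊆ Λ')
    (η : ONConfig V N) {A : Set (ONConfig V N)} (hA : MeasurableSet A) :
    ∫⁻ σ, onSpecification G β Λ σ A ∂(onSpecification G β Λ' η) = onSpecification G β Λ' η A := by
  have hqm : Measurable fun τ => onSpecification G β Λ τ A :=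
    measurable_onSpecification_apply' G β Λ hA
  have hind : Measurable (A.indicator (1 : ONConfig V N → ℝ≥0∞)) := measurable_one.indicator hA
  have hw'm : Measurable (onBoltzmannWeight (N := N) G Λ' β) := measurable_onBoltzmannWeight G Λ' β
  rw [lintegral_onSpecification G β Λ' η hqm, onSpecification_apply_eq G β Λ' η hA]
  congr 1
  refine congrFun (lmarginal_eq_of_subset (μ := fun _ : V => sphereUniform N) hsub
    (hw'm.fun_mul hqm) (hw'm.fun_mul hind) ?_) η
  funext σ
  exact lmarginal_onBoltzmannWeight_mul_onSpecification G β hsub σ hA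

/-! ### The discharge (countable case) -/

/-- **The O(N) kernels form a specification** on a locally finite graph with countable vertex set
(Friedli–Velenik 2017, Lemma 6.20 / §6.10 with Lemma 6.7; Georgii 2011, Prop. 2.5 with Def. 2.9):
probability (`onMeasure.instIsProbabilityMeasure`), `𝓕_{Λᶜ}`-measurability
(`measurable_onSpecification_apply`), properness (`ae_eqOn_compl_onSpecification`) and consistency
(`lintegral_onSpecification_consistent`); no sign condition on `β`. This is the countable case of the
named fact `isSpecification_onSpecification` (which is unsatisfiable for uncountable `V`, where no
kernel is proper in the a.e. sense). [cite: FriedliVelenik2017, Lemma 6.20] -/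
theorem isSpecification_onSpecification_countable [Countable V] (β : ℝ) :
    IsSpecification (onSpecification (N := N) G β) where
  isProbability Λ η := by rw [onSpecification_apply]; infer_instance
  measurable Λ A hA := measurable_onSpecification_apply G β Λ hA
  proper Λ η := ae_eqOn_compl_onSpecification G β Λ η
  consistent Λ Λ' hsub η A hA := lintegral_onSpecification_consistent G β hsub η hA

omit [NeZero N] in
/-- The countable case of the named fact `isSpecification_onSpecification` of `ONModel.lean`, in its
own terms (Friedli–Velenik 2017, Lemma 6.20). [cite: FriedliVelenik2017, Lemma 6.20] -/
theorem isSpecification_onSpecification_of_countable [Countable V] :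
    isSpecification_onSpecification (N := N) G :=
  fun β => isSpecification_onSpecification_countable G β

end Marginal

/-- **The O(N) kernels on `ℤ^d` form a specification** (`Site d` is countable), the case used by
`onGibbsMeasures` (Friedli–Velenik 2017, Lemma 6.20 and §9.1). [cite: FriedliVelenik2017, Lemma 6.20 and §9.1] -/
theorem isSpecification_onSpecification_zd (d : ℕ) [NeZero N] (β : ℝ) :
    IsSpecification (onSpecification (N := N) (zdGraph d) β) :=
  isSpecification_onSpecification_countable (zdGraph d) β

end Literature.Probability.LatticeModels
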